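import Mathlib
import HarnessLib
import Literature.MathematicalPhysics.QuantumLattice.FermiRG.BGM2003Sectors

/-!
# Route `KLProgramme` — K3 engine (stmt-HubbardSuperconductivity-20437), stub (b) (ℓ)/(I2)–(I3), located item «ABS-UMK-COUNT»:
# the bound of `card_targetStrings_le` is `≤ c^L · 2^{n′(L−3)}` — pure arithmetic

Cell gate-hubbard-kl, seat p4 g15.  The headline `AbsUmklappCount.card_targetStrings_le` bounds the anchored absolute count of target strings by
`2L⁴·T_bound·N·K₀^{L−5} + L²2^L·L²·B_fib·(3·2^{n′})^{L−3}`.  This file rewrites that closed term in Lemma-3.1 shape: with `t = 2^{n′}`, `w_{n′} = π/t`, `N = 2t`,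
`T_bound = E(L)·t` (`E(L) ≤ E₁·L²`), `K₀ = 2(2Φ₀t/π + 1) ≤ 2(Φ₀+1)t`, `B_fib ≤ a₆L²`, and `L^6 ≤ 64^L`, the bound is at most
`(128(Φ₀+1)(4E₁+1) + 384(a₆+1))^L · 2^{n′(L−3)}`:

* `sectorWidth_eq_pi_div_pow`, `sectorCount_eq_two_mul_pow` — `w_n = π/2^n`, `N = 2·2^n` in `ℝ`;
* `natCast_pow_six_le` — `L^6 ≤ 64^L`;
* **`targetBound_le_pow`** — the rewriting above (`L ≥ 6`).

Everything is PROVED; no definitions, no named facts; arithmetic only. [folklore]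
-/

noncomputable section

open Real Set
open Literature.MathematicalPhysics.QuantumLattice

namespace Summit.HubbardSuperconductivity.HubbardSuperconductivity.Theorems.AbsUmklappCount

set_option linter.dupNamespace false -- summit = problem name (single-conjunct summit), D-0017

/-- `w_n = π / 2^n`. [folklore] -/
theorem sectorWidth_eq_pi_div_pow (n : ℕ) : sectorWidth n = π / (2 : ℝ) ^ n := rfl

/-- `|O_n| = 2·2^n` as a real number. [folklore] -/
theorem sectorCount_eq_two_mul_pow (n : ℕ) : (sectorCount n : ℝ) = 2 * (2 : ℝ) ^ n := by
  simp [sectorCount, pow_succ, mul_comm]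

/-- `2^{−n} = (2^n)⁻¹`. [folklore] -/
theorem two_zpow_neg_eq_inv_pow (n : ℕ) : (2 : ℝ) ^ (-(n : ℤ)) = ((2 : ℝ) ^ n)⁻¹ := by
  rw [zpow_neg, zpow_natCast]

/-- `L^6 ≤ 64^L`. [folklore] -/
theorem natCast_pow_six_le (L : ℕ) : (L : ℝ) ^ 6 ≤ (64 : ℝ) ^ L := by
  have h1 : (L : ℝ) ≤ (2 : ℝ) ^ L := by exact_mod_cast (Nat.lt_two_pow_self (n := L)).le
  calc (L : ℝ) ^ 6 ≤ ((2 : ℝ) ^ L) ^ 6 := pow_le_pow_left₀ (Nat.cast_nonneg _) h1 6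
    _ = (64 : ℝ) ^ L := by rw [← pow_mul, mul_comm, pow_mul]; norm_num

/-- `x ≤ (x + 1)^L` for `x ≥ 0`, `L ≥ 1`. [folklore] -/
theorem le_add_one_pow {x : ℝ} (hx : 0 ≤ x) {L : ℕ} (hL : 1 ≤ L) : x ≤ (x + 1) ^ L := by
  calc x ≤ x + 1 := by linarith
    _ = (x + 1) ^ 1 := (pow_one _).symm
    _ ≤ (x + 1) ^ L := pow_le_pow_right₀ (by linarith) hL

set_option maxHeartbeats 800000 in -- one long chain of explicit inequalities on a large closed term; 200k times out in `hEL`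
/-- **The bound of `card_targetStrings_le` in Lemma-3.1 shape.**  For `L ≥ 6`, positive constants and `B_fib ≤ a₆L²`, the closed bound is
`≤ (128(Φ₀+1)(4E₁+1) + 384(a₆+1))^L · 2^{n′(L−3)}`, `E₁ = (16c₃/(s₁π) + 1)·(3840A_f(8c₃(1+B_f) + (4B_f+1)s₁π/2)/(c_f²s₁²π²))`. [folklore] -/
theorem targetBound_le_pow {L n' : ℕ} (hL : 6 ≤ L) {c₃ s₁ cf Af Bf Φ₀ Bfib a₆ : ℝ} (hc₃ : 0 < c₃) (hs₁ : 0 < s₁) (hcf : 0 < cf)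
    (hAf : 0 < Af) (hBf : 0 ≤ Bf) (hΦ₀ : 0 ≤ Φ₀) (ha₆ : 0 ≤ a₆) (hBfib : Bfib ≤ a₆ * (L : ℝ) ^ 2) :
    2 * (L : ℝ) ^ 4 *
        ((2 * (L * (4 * c₃ * (2 : ℝ) ^ (-(n' : ℤ)))) / (s₁ / 2 * sectorWidth n') + 1) *
          (960 * Af * (2 * (L * (4 * c₃ * (2 : ℝ) ^ (-(n' : ℤ))) + Bf * (L * (4 * c₃ * (2 : ℝ) ^ (-(n' : ℤ))))) +
            (4 * Bf + 1) * (s₁ / 2 * sectorWidth n')) / cf ^ 2 / (s₁ / 2 * sectorWidth n') ^ 2) *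
        ((sectorCount n' : ℝ) * (2 * (2 * Φ₀ / sectorWidth n' + 1)) ^ (L - 5))) +
      (L : ℝ) ^ 2 * 2 ^ L * (L ^ 2 * (Bfib * (3 * (2 : ℝ) ^ n') ^ (L - 3))) ≤
      (128 * (Φ₀ + 1) * (4 * ((16 * c₃ / (s₁ * π) + 1) * (3840 * Af * (8 * c₃ * (1 + Bf) + (4 * Bf + 1) * s₁ * π / 2) / (cf ^ 2 * s₁ ^ 2 * π ^ 2))) + 1) +
        384 * (a₆ + 1)) ^ L * (2 : ℝ) ^ (n' * (L - 3)) := by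
  have hπ := Real.pi_pos
  have hπ3 := Real.pi_gt_three
  set t : ℝ := (2 : ℝ) ^ n' with ht
  have ht1 : 1 ≤ t := one_le_pow₀ (by norm_num)
  have ht0 : 0 < t := by positivity
  have hL1 : (1 : ℝ) ≤ L := by exact_mod_cast (show 1 ≤ L by omega)
  have hL0 : (0 : ℝ) < L := by linarith
  set E₁ : ℝ := (16 * c₃ / (s₁ * π) + 1) * (3840 * Af * (8 * c₃ * (1 + Bf) + (4 * Bf + 1) * s₁ * π / 2) / (cf ^ 2 * s₁ ^ 2 * π ^ 2)) with hE₁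
  have hE₁0 : 0 ≤ E₁ := by rw [hE₁]; positivity
  -- closed forms
  have hw : sectorWidth n' = π / t := sectorWidth_eq_pi_div_pow n'
  have hN : (sectorCount n' : ℝ) = 2 * t := sectorCount_eq_two_mul_pow n'
  have hz : (2 : ℝ) ^ (-(n' : ℤ)) = t⁻¹ := two_zpow_neg_eq_inv_pow n'
  rw [hw, hN, hz]
  have e1 : 2 * (L * (4 * c₃ * t⁻¹)) / (s₁ / 2 * (π / t)) = 16 * L * c₃ / (s₁ * π) := by
    field_simp
    ring
  have e2 : 960 * Af * (2 * (L * (4 * c₃ * t⁻¹) + Bf * (L * (4 * c₃ * t⁻¹))) + (4 * Bf + 1) * (s₁ / 2 * (π / t))) / cf ^ 2 /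
      (s₁ / 2 * (π / t)) ^ 2 = 3840 * Af * (8 * L * c₃ * (1 + Bf) + (4 * Bf + 1) * s₁ * π / 2) / (cf ^ 2 * s₁ ^ 2 * π ^ 2) * t := by
    field_simp
    ring
  have e3 : 2 * (2 * Φ₀ / (π / t) + 1) = 2 * (2 * Φ₀ * t / π + 1) := by
    field_simp
  rw [e1, e2, e3]
  -- the cone count factor `K ≤ 2(Φ₀+1)t`
  set K : ℝ := 2 * (2 * Φ₀ * t / π + 1) with hK
  have hK0 : 0 ≤ K := by rw [hK]; positivity
  have hKle : K ≤ 2 * (Φ₀ + 1) * t := by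
    have h1 : 2 * Φ₀ * t / π ≤ Φ₀ * t := by
      rw [div_le_iff₀ hπ]; nlinarith [mul_nonneg hΦ₀ ht0.le]
    rw [hK]; nlinarith
  have hKpow : K ^ (L - 5) ≤ (2 * (Φ₀ + 1)) ^ (L - 5) * t ^ (L - 5) := by
    rw [← mul_pow]; exact pow_le_pow_left₀ hK0 hKle _
  -- the fibre factor `E(L)·t ≤ E₁ L² t`
  have hEL : (16 * L * c₃ / (s₁ * π) + 1) * (3840 * Af * (8 * L * c₃ * (1 + Bf) + (4 * Bf + 1) * s₁ * π / 2) / (cf ^ 2 * s₁ ^ 2 * π ^ 2) * t)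
      ≤ E₁ * (L : ℝ) ^ 2 * t := by
    have h1 : 16 * L * c₃ / (s₁ * π) + 1 ≤ (16 * c₃ / (s₁ * π) + 1) * L := by
      have : 0 ≤ 16 * c₃ / (s₁ * π) := by positivity
      have e : 16 * L * c₃ / (s₁ * π) = 16 * c₃ / (s₁ * π) * L := by ring
      rw [e]; nlinarith
    have h2 : 3840 * Af * (8 * L * c₃ * (1 + Bf) + (4 * Bf + 1) * s₁ * π / 2) / (cf ^ 2 * s₁ ^ 2 * π ^ 2) ≤
        3840 * Af * (8 * c₃ * (1 + Bf) + (4 * Bf + 1) * s₁ * π / 2) / (cf ^ 2 * s₁ ^ 2 * π ^ 2) * L := by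
      rw [← mul_div_right_comm, div_le_div_iff_of_pos_right (by positivity)]
      have h3 : 8 * L * c₃ * (1 + Bf) + (4 * Bf + 1) * s₁ * π / 2 ≤ (8 * c₃ * (1 + Bf) + (4 * Bf + 1) * s₁ * π / 2) * L := by
        have : 0 ≤ (4 * Bf + 1) * s₁ * π / 2 := by positivity
        nlinarith
      nlinarith [hAf.le]
    have h10 : 0 ≤ 16 * L * c₃ / (s₁ * π) + 1 := by positivity
    have h20 : 0 ≤ 3840 * Af * (8 * L * c₃ * (1 + Bf) + (4 * Bf + 1) * s₁ * π / 2) / (cf ^ 2 * s₁ ^ 2 * π ^ 2) := by positivity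
    calc (16 * L * c₃ / (s₁ * π) + 1) * (3840 * Af * (8 * L * c₃ * (1 + Bf) + (4 * Bf + 1) * s₁ * π / 2) / (cf ^ 2 * s₁ ^ 2 * π ^ 2) * t)
        = (16 * L * c₃ / (s₁ * π) + 1) * (3840 * Af * (8 * L * c₃ * (1 + Bf) + (4 * Bf + 1) * s₁ * π / 2) / (cf ^ 2 * s₁ ^ 2 * π ^ 2)) * t := by
          ring
      _ ≤ ((16 * c₃ / (s₁ * π) + 1) * L) * (3840 * Af * (8 * c₃ * (1 + Bf) + (4 * Bf + 1) * s₁ * π / 2) / (cf ^ 2 * s₁ ^ 2 * π ^ 2) * L) * t :=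
          mul_le_mul_of_nonneg_right (mul_le_mul h1 h2 h20 (by positivity)) ht0.le
      _ = E₁ * (L : ℝ) ^ 2 * t := by rw [hE₁]; ring
  have hE0 : 0 ≤ (16 * L * c₃ / (s₁ * π) + 1) * (3840 * Af * (8 * L * c₃ * (1 + Bf) + (4 * Bf + 1) * s₁ * π / 2) / (cf ^ 2 * s₁ ^ 2 * π ^ 2) * t) := by
    positivity
  -- powers of `t` and of `L`
  have htpow : t * t * t ^ (L - 5) = t ^ (L - 3) := by
    rw [← pow_two, ← pow_add]; congr 1; omega
  have ht3 : t ^ (L - 3) = (2 : ℝ) ^ (n' * (L - 3)) := by rw [ht, ← pow_mul]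
  have hL6 := natCast_pow_six_le L
  have hΦpow : (2 * (Φ₀ + 1)) ^ (L - 5) ≤ (2 * (Φ₀ + 1)) ^ L := pow_le_pow_right₀ (by linarith) (by omega)
  have h3pow : (3 : ℝ) ^ (L - 3) ≤ (3 : ℝ) ^ L := pow_le_pow_right₀ (by norm_num) (by omega)
  have hLone : 1 ≤ L := by omega
  -- the narrow term
  have hnarrow : 2 * (L : ℝ) ^ 4 * ((16 * L * c₃ / (s₁ * π) + 1) *
        (3840 * Af * (8 * L * c₃ * (1 + Bf) + (4 * Bf + 1) * s₁ * π / 2) / (cf ^ 2 * s₁ ^ 2 * π ^ 2) * t) * (2 * t * K ^ (L - 5))) ≤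
      (128 * (Φ₀ + 1) * (4 * E₁ + 1)) ^ L * t ^ (L - 3) := by
    calc 2 * (L : ℝ) ^ 4 * ((16 * L * c₃ / (s₁ * π) + 1) *
          (3840 * Af * (8 * L * c₃ * (1 + Bf) + (4 * Bf + 1) * s₁ * π / 2) / (cf ^ 2 * s₁ ^ 2 * π ^ 2) * t) * (2 * t * K ^ (L - 5)))
        ≤ 2 * (L : ℝ) ^ 4 * ((E₁ * (L : ℝ) ^ 2 * t) * (2 * t * ((2 * (Φ₀ + 1)) ^ (L - 5) * t ^ (L - 5)))) := by
          refine mul_le_mul_of_nonneg_left (mul_le_mul hEL (mul_le_mul_of_nonneg_left hKpow (by positivity)) (by positivity)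
            (by positivity)) (by positivity)
      _ = 4 * E₁ * (L : ℝ) ^ 6 * (2 * (Φ₀ + 1)) ^ (L - 5) * (t * t * t ^ (L - 5)) := by ring
      _ = 4 * E₁ * (L : ℝ) ^ 6 * (2 * (Φ₀ + 1)) ^ (L - 5) * t ^ (L - 3) := by rw [htpow]
      _ ≤ 4 * E₁ * (64 : ℝ) ^ L * (2 * (Φ₀ + 1)) ^ L * t ^ (L - 3) := by
          have h1 : 4 * E₁ * (L : ℝ) ^ 6 ≤ 4 * E₁ * (64 : ℝ) ^ L := mul_le_mul_of_nonneg_left hL6 (by positivity)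
          have h2 : 4 * E₁ * (L : ℝ) ^ 6 * (2 * (Φ₀ + 1)) ^ (L - 5) ≤ 4 * E₁ * (64 : ℝ) ^ L * (2 * (Φ₀ + 1)) ^ L :=
            mul_le_mul h1 hΦpow (by positivity) (by positivity)
          exact mul_le_mul_of_nonneg_right h2 (by positivity)
      _ ≤ (4 * E₁ + 1) ^ L * ((64 : ℝ) ^ L * (2 * (Φ₀ + 1)) ^ L) * t ^ (L - 3) := by
          rw [show 4 * E₁ * (64 : ℝ) ^ L * (2 * (Φ₀ + 1)) ^ L = 4 * E₁ * ((64 : ℝ) ^ L * (2 * (Φ₀ + 1)) ^ L) by ring]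
          exact mul_le_mul_of_nonneg_right (mul_le_mul_of_nonneg_right (le_add_one_pow (by positivity) hLone) (by positivity))
            (by positivity)
      _ = (128 * (Φ₀ + 1) * (4 * E₁ + 1)) ^ L * t ^ (L - 3) := by
          rw [← mul_pow, ← mul_pow]; congr 2; ring
  -- the wide term
  have hwide : (L : ℝ) ^ 2 * 2 ^ L * (L ^ 2 * (Bfib * (3 * t) ^ (L - 3))) ≤ (384 * (a₆ + 1)) ^ L * t ^ (L - 3) := by
    calc (L : ℝ) ^ 2 * 2 ^ L * (L ^ 2 * (Bfib * (3 * t) ^ (L - 3)))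
        = (L : ℝ) ^ 4 * Bfib * (2 ^ L * 3 ^ (L - 3)) * t ^ (L - 3) := by rw [mul_pow]; ring
      _ ≤ (L : ℝ) ^ 4 * (a₆ * (L : ℝ) ^ 2) * (2 ^ L * 3 ^ L) * t ^ (L - 3) := by
          have h1 : (L : ℝ) ^ 4 * Bfib ≤ (L : ℝ) ^ 4 * (a₆ * (L : ℝ) ^ 2) := mul_le_mul_of_nonneg_left hBfib (by positivity)
          have h2 : (2 : ℝ) ^ L * 3 ^ (L - 3) ≤ 2 ^ L * 3 ^ L := mul_le_mul_of_nonneg_left h3pow (by positivity)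
          exact mul_le_mul_of_nonneg_right (mul_le_mul h1 h2 (by positivity) (by positivity)) (by positivity)
      _ = a₆ * (L : ℝ) ^ 6 * (6 : ℝ) ^ L * t ^ (L - 3) := by
          have h6 : (2 : ℝ) ^ L * 3 ^ L = 6 ^ L := by rw [← mul_pow]; norm_num
          rw [h6]; ring
      _ ≤ a₆ * (64 : ℝ) ^ L * (6 : ℝ) ^ L * t ^ (L - 3) := by
          have h1 : a₆ * (L : ℝ) ^ 6 ≤ a₆ * (64 : ℝ) ^ L := mul_le_mul_of_nonneg_left hL6 ha₆
          exact mul_le_mul_of_nonneg_right (mul_le_mul_of_nonneg_right h1 (by positivity)) (by positivity)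
      _ ≤ (a₆ + 1) ^ L * ((64 : ℝ) ^ L * (6 : ℝ) ^ L) * t ^ (L - 3) := by
          rw [show a₆ * (64 : ℝ) ^ L * (6 : ℝ) ^ L = a₆ * ((64 : ℝ) ^ L * (6 : ℝ) ^ L) by ring]
          exact mul_le_mul_of_nonneg_right (mul_le_mul_of_nonneg_right (le_add_one_pow ha₆ hLone) (by positivity)) (by positivity)
      _ = (384 * (a₆ + 1)) ^ L * t ^ (L - 3) := by
          rw [← mul_pow, ← mul_pow]; congr 2; ring
  -- sum
  have hsum : (128 * (Φ₀ + 1) * (4 * E₁ + 1)) ^ L * t ^ (L - 3) + (384 * (a₆ + 1)) ^ L * t ^ (L - 3) ≤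
      (128 * (Φ₀ + 1) * (4 * E₁ + 1) + 384 * (a₆ + 1)) ^ L * t ^ (L - 3) := by
    rw [← add_mul]
    refine mul_le_mul_of_nonneg_right (pow_add_pow_le (by positivity) (by positivity) (by omega)) (by positivity)
  rw [← ht3]
  exact (add_le_add hnarrow hwide).trans hsum

end Summit.HubbardSuperconductivity.HubbardSuperconductivity.Theorems.AbsUmklappCount

end
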